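import Summits.FinalStateConjecture.FinalStateConjecture.Theorems.PhotonSphereChannelsEnergyIdentity

/-!
# Route PhotonSphereChannels — energy–flux calculus for `C²` solutions of `u_tt − u_xx + V u = 0` (II)

Sequel to `PhotonSphereChannelsEnergyIdentity` (the energy identity with affinely moving ends).
Here the potential is in addition NON-NEGATIVE, `V ≥ 0`, as for the Regge–Wheeler family
`V_{s,ℓ}`, `s ≤ 2`, `s ≤ ℓ`, of the route's three linear items.  Contents (`u : ℝ × ℝ → ℝ` a `C²`
solution, `z = (t, x)`, Fréchet partials, energy density `e = u_t² + u_x² + V u²`):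

* `|m| ≤ e` for the momentum density `m = 2 u_t u_x`, `0 ≤ e`;
* **domain of dependence**: for `t₁ ≤ t₂`,
  `∫_{a+(t₂−t₁)}^{b−(t₂−t₁)} e(t₂,·) ≤ ∫_a^b e(t₁,·)` (future) and
  `∫_a^b e(t₁,·) ≤ ∫_{a−(t₂−t₁)}^{b+(t₂−t₁)} e(t₂,·)` (past, read forward);
* the same on half-lines `(c, ∞)`, `(−∞, c)` as `lintegral`s of `ENNReal.ofReal ∘ e` (monotone
  convergence over `Ioc` exhaustions), which is the form the route decls use;
* **monotonicity of the two-ended exterior energy** `∫⁻_{ρ + |t| < |x − x_c|} e(t,·)` in `|t|`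
  on each time-sign for `0 ≤ ρ` (`exteriorEnergy_mono_abs`): energy only leaves a region whose
  ends recede at the speed of light.  This is the rigorous content of "Lemma A" (time symmetry +
  channel-energy monotonicity ⇒ the `liminf`s in `UniformPhotonSphereChannels` are limits = infima,
  attained from any finite time on) in the refutation notes attached to item
  stmt-FinalStateConjecture-10045, and it is equally the first step of any proof of
  `FixedModeChannels`.

The translation to the route's curried vocabulary (`ψ : ℝ → ℝ → ℝ`, `deriv`, `iteratedDeriv 2`)
and the Regge–Wheeler specialisation follow in `PhotonSphereChannelsExteriorEnergy`.
No new definitions; standard material [folklore].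
-/

namespace Summit.FinalStateConjecture.FinalStateConjecture.Theorems

open MeasureTheory Set Filter Topology intervalIntegral

noncomputable section

namespace WaveEnergy

variable {u : ℝ × ℝ → ℝ} {V : ℝ → ℝ}

/-! ### Domain-of-dependence energy inequalities (`V ≥ 0`) -/

/-- With `V ≥ 0` the energy density dominates the momentum density: `0 ≤ e − m`
(`e − m = (u_t − u_x)² + V u²`). -/
theorem momentum_le_energy (hV0 : ∀ x, 0 ≤ V x) {e m : ℝ × ℝ → ℝ}
    (he : ∀ z, e z = (fderiv ℝ u z (1, 0)) ^ 2 + (fderiv ℝ u z (0, 1)) ^ 2 + V z.2 * u z ^ 2)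
    (hm : ∀ z, m z = 2 * fderiv ℝ u z (1, 0) * fderiv ℝ u z (0, 1)) (z : ℝ × ℝ) :
    m z ≤ e z := by
  rw [he, hm]
  nlinarith [sq_nonneg (fderiv ℝ u z (1, 0) - fderiv ℝ u z (0, 1)),
    mul_nonneg (hV0 z.2) (sq_nonneg (u z))]

/-- With `V ≥ 0`: `0 ≤ e + m` (`e + m = (u_t + u_x)² + V u²`). -/
theorem neg_momentum_le_energy (hV0 : ∀ x, 0 ≤ V x) {e m : ℝ × ℝ → ℝ}
    (he : ∀ z, e z = (fderiv ℝ u z (1, 0)) ^ 2 + (fderiv ℝ u z (0, 1)) ^ 2 + V z.2 * u z ^ 2)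
    (hm : ∀ z, m z = 2 * fderiv ℝ u z (1, 0) * fderiv ℝ u z (0, 1)) (z : ℝ × ℝ) :
    -m z ≤ e z := by
  rw [he, hm]
  nlinarith [sq_nonneg (fderiv ℝ u z (1, 0) + fderiv ℝ u z (0, 1)),
    mul_nonneg (hV0 z.2) (sq_nonneg (u z))]

/-- With `V ≥ 0` the energy density is non-negative. -/
theorem energyDensity_nonneg (hV0 : ∀ x, 0 ≤ V x) {e : ℝ × ℝ → ℝ}
    (he : ∀ z, e z = (fderiv ℝ u z (1, 0)) ^ 2 + (fderiv ℝ u z (0, 1)) ^ 2 + V z.2 * u z ^ 2)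
    (z : ℝ × ℝ) : 0 ≤ e z := by
  rw [he]
  nlinarith [sq_nonneg (fderiv ℝ u z (1, 0)), sq_nonneg (fderiv ℝ u z (0, 1)),
    mul_nonneg (hV0 z.2) (sq_nonneg (u z))]

/-- **Future domain of dependence.** For a `C²` solution of `u_tt − u_xx + V u = 0` with `V ≥ 0`
differentiable, and `t₁ ≤ t₂`, the energy on the shrunken interval `[a + (t₂ − t₁), b − (t₂ − t₁)]`
at time `t₂` is at most the energy on `[a, b]` at time `t₁` (oriented integrals; no hypothesis
`a ≤ b` is needed). [folklore] -/
theorem energy_shrinking_le (hu : ContDiff ℝ 2 u) (hV : Differentiable ℝ V) (hV0 : ∀ x, 0 ≤ V x)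
    (hsol : ∀ z : ℝ × ℝ, fderiv ℝ (fderiv ℝ u) z (1, 0) (1, 0)
      - fderiv ℝ (fderiv ℝ u) z (0, 1) (0, 1) + V z.2 * u z = 0)
    {e : ℝ × ℝ → ℝ}
    (he : ∀ z, e z = (fderiv ℝ u z (1, 0)) ^ 2 + (fderiv ℝ u z (0, 1)) ^ 2 + V z.2 * u z ^ 2)
    (a b : ℝ) {t₁ t₂ : ℝ} (ht : t₁ ≤ t₂) :
    (∫ x in (a + (t₂ - t₁))..(b - (t₂ - t₁)), e (t₂, x)) ≤ ∫ x in a..b, e (t₁, x) := by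
  have hm : ∀ z : ℝ × ℝ, (fun z => 2 * fderiv ℝ u z (1, 0) * fderiv ℝ u z (0, 1)) z
      = 2 * fderiv ℝ u z (1, 0) * fderiv ℝ u z (0, 1) := fun z => rfl
  have key := energy_identity_affine hu hV hsol he hm (a - t₁) 1 (b + t₁) (-1) t₁ t₂
  have e1 : a - t₁ + 1 * t₂ = a + (t₂ - t₁) := by ring
  have e2 : b + t₁ + -1 * t₂ = b - (t₂ - t₁) := by ring
  have e3 : a - t₁ + 1 * t₁ = a := by ring
  have e4 : b + t₁ + -1 * t₁ = b := by ring
  rw [e1, e2, e3, e4] at key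
  have hle : (∫ t in t₁..t₂,
      ((fun z : ℝ × ℝ => 2 * fderiv ℝ u z (1, 0) * fderiv ℝ u z (0, 1)) (t, b + t₁ + -1 * t)
          + -1 * e (t, b + t₁ + -1 * t))
        - ((fun z : ℝ × ℝ => 2 * fderiv ℝ u z (1, 0) * fderiv ℝ u z (0, 1)) (t, a - t₁ + 1 * t)
          + 1 * e (t, a - t₁ + 1 * t))) ≤ 0 := by
    have h : 0 ≤ ∫ t in t₁..t₂,
      -(((fun z : ℝ × ℝ => 2 * fderiv ℝ u z (1, 0) * fderiv ℝ u z (0, 1)) (t, b + t₁ + -1 * t)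
          + -1 * e (t, b + t₁ + -1 * t))
        - ((fun z : ℝ × ℝ => 2 * fderiv ℝ u z (1, 0) * fderiv ℝ u z (0, 1)) (t, a - t₁ + 1 * t)
          + 1 * e (t, a - t₁ + 1 * t))) := intervalIntegral.integral_nonneg ht (fun t _ => by
        have h1 := momentum_le_energy hV0 he hm (t, b + t₁ + -1 * t)
        have h2 := neg_momentum_le_energy hV0 he hm (t, a - t₁ + 1 * t)
        simp only at h1 h2 ⊢
        linarith)
    rw [intervalIntegral.integral_neg] at h
    linarith
  linarith

/-- **Past domain of dependence** (the time-reversed statement, read forward in time). For a `C²`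
solution of `u_tt − u_xx + V u = 0` with `V ≥ 0` differentiable and `t₁ ≤ t₂`, the energy on
`[a, b]` at time `t₁` is at most the energy on the enlarged interval
`[a − (t₂ − t₁), b + (t₂ − t₁)]` at time `t₂`. [folklore] -/
theorem energy_le_expanding (hu : ContDiff ℝ 2 u) (hV : Differentiable ℝ V) (hV0 : ∀ x, 0 ≤ V x)
    (hsol : ∀ z : ℝ × ℝ, fderiv ℝ (fderiv ℝ u) z (1, 0) (1, 0)
      - fderiv ℝ (fderiv ℝ u) z (0, 1) (0, 1) + V z.2 * u z = 0)
    {e : ℝ × ℝ → ℝ}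
    (he : ∀ z, e z = (fderiv ℝ u z (1, 0)) ^ 2 + (fderiv ℝ u z (0, 1)) ^ 2 + V z.2 * u z ^ 2)
    (a b : ℝ) {t₁ t₂ : ℝ} (ht : t₁ ≤ t₂) :
    (∫ x in a..b, e (t₁, x)) ≤ ∫ x in (a - (t₂ - t₁))..(b + (t₂ - t₁)), e (t₂, x) := by
  have hm : ∀ z : ℝ × ℝ, (fun z => 2 * fderiv ℝ u z (1, 0) * fderiv ℝ u z (0, 1)) z
      = 2 * fderiv ℝ u z (1, 0) * fderiv ℝ u z (0, 1) := fun z => rfl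
  have key := energy_identity_affine hu hV hsol he hm (a + t₁) (-1) (b - t₁) 1 t₁ t₂
  have e1 : a + t₁ + -1 * t₂ = a - (t₂ - t₁) := by ring
  have e2 : b - t₁ + 1 * t₂ = b + (t₂ - t₁) := by ring
  have e3 : a + t₁ + -1 * t₁ = a := by ring
  have e4 : b - t₁ + 1 * t₁ = b := by ring
  rw [e1, e2, e3, e4] at key
  have hge : 0 ≤ (∫ t in t₁..t₂,
      ((fun z : ℝ × ℝ => 2 * fderiv ℝ u z (1, 0) * fderiv ℝ u z (0, 1)) (t, b - t₁ + 1 * t)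
          + 1 * e (t, b - t₁ + 1 * t))
        - ((fun z : ℝ × ℝ => 2 * fderiv ℝ u z (1, 0) * fderiv ℝ u z (0, 1)) (t, a + t₁ + -1 * t)
          + -1 * e (t, a + t₁ + -1 * t))) :=
    intervalIntegral.integral_nonneg ht (fun t _ => by
        have h1 := neg_momentum_le_energy hV0 he hm (t, b - t₁ + 1 * t)
        have h2 := momentum_le_energy hV0 he hm (t, a + t₁ + -1 * t)
        simp only at h1 h2 ⊢
        linarith)
  linarith

/-! ### From finite intervals to half-lines (`lintegral` form) -/

/-- For `p ≤ q` and a continuous non-negative `f`, the `lintegral` of `ofReal ∘ f` over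
`Ioc p q` is `ofReal` of the interval integral. -/
theorem lintegral_Ioc_eq_ofReal_intervalIntegral {f : ℝ → ℝ} (hf : Continuous f)
    (hf0 : ∀ x, 0 ≤ f x) {p q : ℝ} (hpq : p ≤ q) :
    ∫⁻ x in Ioc p q, ENNReal.ofReal (f x) = ENNReal.ofReal (∫ x in p..q, f x) := by
  rw [intervalIntegral.integral_of_le hpq,
    ofReal_integral_eq_lintegral_ofReal hf.integrableOn_Ioc
      (ae_restrict_of_forall_mem measurableSet_Ioc fun x _ => hf0 x)]

/-- `Ioi a` is the increasing union of the intervals `Ioc a (a + n)`. -/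
theorem iUnion_Ioc_add_nat (a : ℝ) : ⋃ n : ℕ, Ioc a (a + n) = Ioi a := by
  ext x
  simp only [mem_iUnion, mem_Ioc, mem_Ioi]
  constructor
  · rintro ⟨n, h1, _⟩
    exact h1
  · intro h
    obtain ⟨n, hn⟩ := exists_nat_ge (x - a)
    exact ⟨n, h, by linarith⟩

/-- `Iic b` is the increasing union of the intervals `Ioc (b - n) b`. -/
theorem iUnion_Ioc_sub_nat (b : ℝ) : ⋃ n : ℕ, Ioc (b - n) b = Iic b := by
  ext x
  simp only [mem_iUnion, mem_Ioc, mem_Iic]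
  constructor
  · rintro ⟨n, _, h2⟩
    exact h2
  · intro h
    obtain ⟨n, hn⟩ := exists_nat_gt (b - x)
    exact ⟨n, by linarith, h⟩

/-- Half-line comparison principle (right half-lines): if every finite piece `∫_a^{a+n} f` is
dominated by some `∫_b^{R'} g` with `b ≤ R'`, then `∫⁻_{(a,∞)} f ≤ ∫⁻_{(b,∞)} g`
(`f, g` continuous and non-negative). -/
theorem lintegral_Ioi_le_of_forall {f g : ℝ → ℝ} (hf : Continuous f) (hg : Continuous g)
    (hf0 : ∀ x, 0 ≤ f x) (hg0 : ∀ x, 0 ≤ g x) {a b : ℝ}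
    (h : ∀ n : ℕ, ∃ R', b ≤ R' ∧ ∫ x in a..(a + n), f x ≤ ∫ x in b..R', g x) :
    ∫⁻ x in Ioi a, ENNReal.ofReal (f x) ≤ ∫⁻ x in Ioi b, ENNReal.ofReal (g x) := by
  have hdir : Directed (· ⊆ ·) (fun n : ℕ => Ioc a (a + n)) := by
    refine Monotone.directed_le fun i j hij => Ioc_subset_Ioc le_rfl ?_
    exact add_le_add_right (Nat.cast_le.mpr hij) a
  rw [← iUnion_Ioc_add_nat a, setLIntegral_iUnion_of_directed _ hdir]
  refine iSup_le fun n => ?_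
  obtain ⟨R', hR', hle⟩ := h n
  have han : a ≤ a + n := le_add_of_nonneg_right (Nat.cast_nonneg n)
  rw [lintegral_Ioc_eq_ofReal_intervalIntegral hf hf0 han]
  calc ENNReal.ofReal (∫ x in a..(a + n), f x)
      ≤ ENNReal.ofReal (∫ x in b..R', g x) := ENNReal.ofReal_le_ofReal hle
    _ = ∫⁻ x in Ioc b R', ENNReal.ofReal (g x) :=
        (lintegral_Ioc_eq_ofReal_intervalIntegral hg hg0 hR').symm
    _ ≤ ∫⁻ x in Ioi b, ENNReal.ofReal (g x) := lintegral_mono_set Ioc_subset_Ioi_self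

/-- Half-line comparison principle (left half-lines): if every finite piece `∫_{b-n}^{b} f` is
dominated by some `∫_{R'}^{c} g` with `R' ≤ c`, then `∫⁻_{(-∞,b)} f ≤ ∫⁻_{(-∞,c)} g`
(`f, g` continuous and non-negative). -/
theorem lintegral_Iio_le_of_forall {f g : ℝ → ℝ} (hf : Continuous f) (hg : Continuous g)
    (hf0 : ∀ x, 0 ≤ f x) (hg0 : ∀ x, 0 ≤ g x) {b c : ℝ}
    (h : ∀ n : ℕ, ∃ R', R' ≤ c ∧ ∫ x in (b - n)..b, f x ≤ ∫ x in R'..c, g x) :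
    ∫⁻ x in Iio b, ENNReal.ofReal (f x) ≤ ∫⁻ x in Iio c, ENNReal.ofReal (g x) := by
  have hdir : Directed (· ⊆ ·) (fun n : ℕ => Ioc (b - n) b) := by
    refine Monotone.directed_le fun i j hij => Ioc_subset_Ioc ?_ le_rfl
    exact sub_le_sub_left (Nat.cast_le.mpr hij) b
  rw [setLIntegral_congr (Iio_ae_eq_Iic (μ := volume) (a := b)),
    setLIntegral_congr (Iio_ae_eq_Iic (μ := volume) (a := c)),
    ← iUnion_Ioc_sub_nat b, setLIntegral_iUnion_of_directed _ hdir]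
  refine iSup_le fun n => ?_
  obtain ⟨R', hR', hle⟩ := h n
  have hbn : b - n ≤ b := sub_le_self b (Nat.cast_nonneg n)
  rw [lintegral_Ioc_eq_ofReal_intervalIntegral hf hf0 hbn]
  calc ENNReal.ofReal (∫ x in (b - n)..b, f x)
      ≤ ENNReal.ofReal (∫ x in R'..c, g x) := ENNReal.ofReal_le_ofReal hle
    _ = ∫⁻ x in Ioc R' c, ENNReal.ofReal (g x) :=
        (lintegral_Ioc_eq_ofReal_intervalIntegral hg hg0 hR').symm
    _ ≤ ∫⁻ x in Iic c, ENNReal.ofReal (g x) := lintegral_mono_set Ioc_subset_Iic_self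

/-- **Exterior energy, right half-line, forward in time.** For `t₁ ≤ t₂` the energy of a `C²`
solution (`V ≥ 0` differentiable) on `(c + (t₂ − t₁), ∞)` at time `t₂` is at most its energy on
`(c, ∞)` at time `t₁`. [folklore] -/
theorem lintegral_Ioi_shrinking_le (hu : ContDiff ℝ 2 u) (hV : Differentiable ℝ V)
    (hV0 : ∀ x, 0 ≤ V x)
    (hsol : ∀ z : ℝ × ℝ, fderiv ℝ (fderiv ℝ u) z (1, 0) (1, 0)
      - fderiv ℝ (fderiv ℝ u) z (0, 1) (0, 1) + V z.2 * u z = 0)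
    {e : ℝ × ℝ → ℝ}
    (he : ∀ z, e z = (fderiv ℝ u z (1, 0)) ^ 2 + (fderiv ℝ u z (0, 1)) ^ 2 + V z.2 * u z ^ 2)
    (c : ℝ) {t₁ t₂ : ℝ} (ht : t₁ ≤ t₂) :
    ∫⁻ x in Ioi (c + (t₂ - t₁)), ENNReal.ofReal (e (t₂, x))
      ≤ ∫⁻ x in Ioi c, ENNReal.ofReal (e (t₁, x)) := by
  have hec := continuous_energyDensity hu hV he
  have he0 := energyDensity_nonneg hV0 he
  refine lintegral_Ioi_le_of_forall (hec.comp (Continuous.prodMk_right t₂))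
    (hec.comp (Continuous.prodMk_right t₁)) (fun x => he0 _) (fun x => he0 _) fun n => ?_
  refine ⟨c + (t₂ - t₁) + n + (t₂ - t₁), by linarith, ?_⟩
  have key := energy_shrinking_le hu hV hV0 hsol he c (c + (t₂ - t₁) + n + (t₂ - t₁)) ht
  have e1 : c + (t₂ - t₁) + ↑n + (t₂ - t₁) - (t₂ - t₁) = c + (t₂ - t₁) + n := by ring
  rw [e1] at key
  exact key

/-- **Exterior energy, right half-line, backward in time** (read forward: expanding region). For
`t₁ ≤ t₂` the energy on `(c, ∞)` at time `t₁` is at most the energy on `(c − (t₂ − t₁), ∞)` at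
time `t₂`. [folklore] -/
theorem lintegral_Ioi_le_expanding (hu : ContDiff ℝ 2 u) (hV : Differentiable ℝ V)
    (hV0 : ∀ x, 0 ≤ V x)
    (hsol : ∀ z : ℝ × ℝ, fderiv ℝ (fderiv ℝ u) z (1, 0) (1, 0)
      - fderiv ℝ (fderiv ℝ u) z (0, 1) (0, 1) + V z.2 * u z = 0)
    {e : ℝ × ℝ → ℝ}
    (he : ∀ z, e z = (fderiv ℝ u z (1, 0)) ^ 2 + (fderiv ℝ u z (0, 1)) ^ 2 + V z.2 * u z ^ 2)
    (c : ℝ) {t₁ t₂ : ℝ} (ht : t₁ ≤ t₂) :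
    ∫⁻ x in Ioi c, ENNReal.ofReal (e (t₁, x))
      ≤ ∫⁻ x in Ioi (c - (t₂ - t₁)), ENNReal.ofReal (e (t₂, x)) := by
  have hec := continuous_energyDensity hu hV he
  have he0 := energyDensity_nonneg hV0 he
  refine lintegral_Ioi_le_of_forall (hec.comp (Continuous.prodMk_right t₁))
    (hec.comp (Continuous.prodMk_right t₂)) (fun x => he0 _) (fun x => he0 _) fun n => ?_
  refine ⟨c + n + (t₂ - t₁), by linarith, ?_⟩
  exact energy_le_expanding hu hV hV0 hsol he c (c + n) ht

/-- **Exterior energy, left half-line, forward in time.** For `t₁ ≤ t₂` the energy on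
`(−∞, c − (t₂ − t₁))` at time `t₂` is at most the energy on `(−∞, c)` at time `t₁`. [folklore] -/
theorem lintegral_Iio_shrinking_le (hu : ContDiff ℝ 2 u) (hV : Differentiable ℝ V)
    (hV0 : ∀ x, 0 ≤ V x)
    (hsol : ∀ z : ℝ × ℝ, fderiv ℝ (fderiv ℝ u) z (1, 0) (1, 0)
      - fderiv ℝ (fderiv ℝ u) z (0, 1) (0, 1) + V z.2 * u z = 0)
    {e : ℝ × ℝ → ℝ}
    (he : ∀ z, e z = (fderiv ℝ u z (1, 0)) ^ 2 + (fderiv ℝ u z (0, 1)) ^ 2 + V z.2 * u z ^ 2)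
    (c : ℝ) {t₁ t₂ : ℝ} (ht : t₁ ≤ t₂) :
    ∫⁻ x in Iio (c - (t₂ - t₁)), ENNReal.ofReal (e (t₂, x))
      ≤ ∫⁻ x in Iio c, ENNReal.ofReal (e (t₁, x)) := by
  have hec := continuous_energyDensity hu hV he
  have he0 := energyDensity_nonneg hV0 he
  refine lintegral_Iio_le_of_forall (hec.comp (Continuous.prodMk_right t₂))
    (hec.comp (Continuous.prodMk_right t₁)) (fun x => he0 _) (fun x => he0 _) fun n => ?_
  refine ⟨c - (t₂ - t₁) - n - (t₂ - t₁), by linarith, ?_⟩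
  have key := energy_shrinking_le hu hV hV0 hsol he (c - (t₂ - t₁) - n - (t₂ - t₁)) c ht
  have e1 : c - (t₂ - t₁) - ↑n - (t₂ - t₁) + (t₂ - t₁) = c - (t₂ - t₁) - n := by ring
  rw [e1] at key
  exact key

/-- **Exterior energy, left half-line, backward in time** (read forward: expanding region). For
`t₁ ≤ t₂` the energy on `(−∞, c)` at time `t₁` is at most the energy on `(−∞, c + (t₂ − t₁))` at
time `t₂`. [folklore] -/
theorem lintegral_Iio_le_expanding (hu : ContDiff ℝ 2 u) (hV : Differentiable ℝ V)
    (hV0 : ∀ x, 0 ≤ V x)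
    (hsol : ∀ z : ℝ × ℝ, fderiv ℝ (fderiv ℝ u) z (1, 0) (1, 0)
      - fderiv ℝ (fderiv ℝ u) z (0, 1) (0, 1) + V z.2 * u z = 0)
    {e : ℝ × ℝ → ℝ}
    (he : ∀ z, e z = (fderiv ℝ u z (1, 0)) ^ 2 + (fderiv ℝ u z (0, 1)) ^ 2 + V z.2 * u z ^ 2)
    (c : ℝ) {t₁ t₂ : ℝ} (ht : t₁ ≤ t₂) :
    ∫⁻ x in Iio c, ENNReal.ofReal (e (t₁, x))
      ≤ ∫⁻ x in Iio (c + (t₂ - t₁)), ENNReal.ofReal (e (t₂, x)) := by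
  have hec := continuous_energyDensity hu hV he
  have he0 := energyDensity_nonneg hV0 he
  refine lintegral_Iio_le_of_forall (hec.comp (Continuous.prodMk_right t₁))
    (hec.comp (Continuous.prodMk_right t₂)) (fun x => he0 _) (fun x => he0 _) fun n => ?_
  refine ⟨c - n - (t₂ - t₁), by linarith, ?_⟩
  exact energy_le_expanding hu hV hV0 hsol he (c - n) c ht

/-! ### Two-ended exterior regions `{ρ + |t| < |x − x_c|}` -/

/-- The two-ended exterior region is the union of two half-lines. -/
theorem setOf_lt_abs_sub_eq (xc d : ℝ) :
    {x : ℝ | d < |x - xc|} = Iio (xc - d) ∪ Ioi (xc + d) := by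
  ext x
  simp only [mem_setOf_eq, mem_union, mem_Iio, mem_Ioi, lt_abs]
  constructor
  · rintro (h | h)
    · exact Or.inr (by linarith)
    · exact Or.inl (by linarith)
  · rintro (h | h)
    · exact Or.inr (by linarith)
    · exact Or.inl (by linarith)

/-- For `0 ≤ d` the two half-lines of the exterior region are disjoint, so the exterior energy is
the sum of the two half-line energies. -/
theorem lintegral_setOf_lt_abs_sub (xc : ℝ) {d : ℝ} (hd : 0 ≤ d) (F : ℝ → ENNReal) :
    ∫⁻ x in {x : ℝ | d < |x - xc|}, F x = (∫⁻ x in Iio (xc - d), F x) + ∫⁻ x in Ioi (xc + d), F x := by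
  rw [setOf_lt_abs_sub_eq, lintegral_union measurableSet_Ioi]
  rw [Set.disjoint_left]
  intro x h1 h2
  simp only [mem_Iio] at h1
  simp only [mem_Ioi] at h2
  linarith

/-- **Monotonicity of the two-ended exterior energy in `|t|`** (Fréchet form). For a `C²` solution
`u` of `u_tt − u_xx + V u = 0` on `ℝ × ℝ` with `V ≥ 0` differentiable, `0 ≤ ρ`, and two times of
the same sign with `|t₁| ≤ |t₂|`, the energy left on `{ρ + |t₂| < |x − x_c|}` at time `t₂` is at
most the energy on `{ρ + |t₁| < |x − x_c|}` at time `t₁`: energy can only LEAVE a region receding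
at the speed of light (future and past domain of dependence). This is "Lemma A" of the
refutation notes on item stmt-FinalStateConjecture-10045. [folklore] -/
theorem exteriorEnergy_mono_abs (hu : ContDiff ℝ 2 u) (hV : Differentiable ℝ V)
    (hV0 : ∀ x, 0 ≤ V x)
    (hsol : ∀ z : ℝ × ℝ, fderiv ℝ (fderiv ℝ u) z (1, 0) (1, 0)
      - fderiv ℝ (fderiv ℝ u) z (0, 1) (0, 1) + V z.2 * u z = 0)
    {e : ℝ × ℝ → ℝ}
    (he : ∀ z, e z = (fderiv ℝ u z (1, 0)) ^ 2 + (fderiv ℝ u z (0, 1)) ^ 2 + V z.2 * u z ^ 2)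
    (xc : ℝ) {ρ : ℝ} (hρ : 0 ≤ ρ) {t₁ t₂ : ℝ} (habs : |t₁| ≤ |t₂|) (hsign : 0 ≤ t₁ * t₂) :
    ∫⁻ x in {x : ℝ | ρ + |t₂| < |x - xc|}, ENNReal.ofReal (e (t₂, x))
      ≤ ∫⁻ x in {x : ℝ | ρ + |t₁| < |x - xc|}, ENNReal.ofReal (e (t₁, x)) := by
  have hd1 : 0 ≤ ρ + |t₁| := add_nonneg hρ (abs_nonneg _)
  have hd2 : 0 ≤ ρ + |t₂| := add_nonneg hρ (abs_nonneg _)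
  rw [lintegral_setOf_lt_abs_sub xc hd2, lintegral_setOf_lt_abs_sub xc hd1]
  rcases le_or_gt 0 t₂ with h2 | h2
  · -- `0 ≤ t₁ ≤ t₂`: forward, shrinking
    have h1 : 0 ≤ t₁ := by
      rcases h2.lt_or_eq with h2' | h2'
      · exact nonneg_of_mul_nonneg_left hsign h2'
      · rw [← h2', abs_zero] at habs
        exact (abs_nonpos_iff.mp habs).ge
    rw [abs_of_nonneg h1, abs_of_nonneg h2] at habs ⊢
    refine add_le_add ?_ ?_
    · have key := lintegral_Iio_shrinking_le hu hV hV0 hsol he (xc - (ρ + t₁)) habs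
      have e1 : xc - (ρ + t₁) - (t₂ - t₁) = xc - (ρ + t₂) := by ring
      rwa [e1] at key
    · have key := lintegral_Ioi_shrinking_le hu hV hV0 hsol he (xc + (ρ + t₁)) habs
      have e1 : xc + (ρ + t₁) + (t₂ - t₁) = xc + (ρ + t₂) := by ring
      rwa [e1] at key
  · -- `t₂ ≤ t₁ ≤ 0`: backward, i.e. expanding forward from `t₂` to `t₁`
    have h1 : t₁ ≤ 0 := by
      by_contra h1'
      have : t₁ * t₂ < 0 := mul_neg_of_pos_of_neg (lt_of_not_ge h1') h2
      linarith
    rw [abs_of_nonpos h1, abs_of_neg h2] at habs ⊢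
    have h21 : t₂ ≤ t₁ := by linarith
    refine add_le_add ?_ ?_
    · have key := lintegral_Iio_le_expanding hu hV hV0 hsol he (xc - (ρ + -t₂)) h21
      have e1 : xc - (ρ + -t₂) + (t₁ - t₂) = xc - (ρ + -t₁) := by ring
      rwa [e1] at key
    · have key := lintegral_Ioi_le_expanding hu hV hV0 hsol he (xc + (ρ + -t₂)) h21
      have e1 : xc + (ρ + -t₂) - (t₁ - t₂) = xc + (ρ + -t₁) := by ring
      rwa [e1] at key

end WaveEnergy

end

end Summit.FinalStateConjecture.FinalStateConjecture.Theorems
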